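import Summits.RiemannHypothesis.RiemannHypothesis.Theorems.JensenLogBandArcTransformEstimate
import Summits.RiemannHypothesis.RiemannHypothesis.Theorems.JensenLogBandFarZoneCompetitor
import Summits.RiemannHypothesis.RiemannHypothesis.Theorems.JensenLogBandShellRegime
import Summits.RiemannHypothesis.RiemannHypothesis.Theorems.JensenLogBandShellFarNumerics
import Summits.RiemannHypothesis.RiemannHypothesis.Theorems.JensenLogBandArcSaddle
import Summits.RiemannHypothesis.RiemannHypothesis.Theorems.JensenLogBandArcDensityDeriv
import Summits.RiemannHypothesis.RiemannHypothesis.Theorems.JensenLogBandShellFarPieces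
import Literature.Analysis.InverseSpectral.HelicalFunctionProofsLattice
import Literature.Probability.LatticeModels.ImprovedTreeDiagramBoundProofs
import Literature.NumberTheory.LFunctions.ZetaClassicalRegionBounds
import HarnessLib

/-!
# The FAR ZONE of the top shell: `stub_shellFar` (BAND crux `XiDerivBandRealAllRates`)

RH ladder column JENSEN, rung J-P(P3) «log band», BAND crux `XiDerivBandRealAllRates`
(stmt-RiemannHypothesis-19913) of route «JensenLogBand», line «band-one-window» (u-arc, top-shell
reshape), lead rh-jensen-prover g8 — the registered stub `stub_shellFar`: for `7 ≤ c < 8`, `k ≥ k₂(c)`,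
in the top shell `e^{c(k−1)}/4 ≤ ‖(a+iT)²‖ < e^{ck}` and for `a₀(c) = 2/c − ¼ < a ≤ ½`:
`‖U_{k,h}(−a+iT)‖ < ‖U_{k,h}(a+iT)‖`, `h = h(k,T)`. RH-FREE. WHAT THIS IS NOT: nothing here bears on
zeros of `ζ` off the line or the truth of RH.

Mechanism (all inputs in the tree): the OWN transform `U_{k,h}(a+iT)` is within
`(k!/2π)‖I(φ₀)‖(‖ζ*‖W + πF + |h−r|V)` of its Laplace main term of size `(k!/2π)‖I(φ₀)‖‖ζ*‖(π/‖w‖)^{1/2}`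
(`LogBandArc.norm_xiSqArcU_sub_arcMainTerm_le'`, S5), with `W ≤ 1/√k`, `(π/‖w‖)^{1/2} ≥ 2/√k`,
`‖ζ*‖ ≥ a₀`; the COMPETITOR `U_{k,h}(−a+iT)` has its whole arc at abscissae `≤ ½ − a + h` and is
bounded pointwise against the own peak by `672·log(T+h)·e^{4h+9}·e^{−(σ*−1−δ)(ℓ/2−1)}·‖I(φ₀)‖`
(`LogBandArc.norm_arcIntegrandU_competitor_le`, eng-2 g6), `σ* − 1 − δ ≥ a₀`, `ℓ ≍ ck/2`; the
exponentially small terms are `≤ a₀/(2√k)` for `k ≥ k₂` (`Theorems/JensenLogBandShellFarNumerics`).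
-/

noncomputable section

-- single-problem summit: `Summit.RiemannHypothesis.RiemannHypothesis.…` is the tree convention
set_option linter.dupNamespace false

open Complex Real Set MeasureTheory intervalIntegral



namespace Summit.RiemannHypothesis.RiemannHypothesis.Cruxes.XiDerivBandRealAllRates.UArc

open Literature.NumberTheory.LFunctions
open Summit.RiemannHypothesis.RiemannHypothesis.Theorems.JensenPolynomials.LogBandArc

/-- **stub_shellFar** (L; RH-FREE): for `7 ≤ c < 8` and `k ≥ k₂(c)`, in the top shell
`e^{c(k−1)}/4 ≤ a² + T² < e^{ck}` and for `a₀(c) = 2/c − ¼ < a ≤ ½`: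
`‖U_{k,h}(−a + iT)‖ < ‖U_{k,h}(a + iT)‖`. Mechanism: sup × length bound of the competitor's right
half-arc (abscissae `≤ ½ − a + h < 1 + (h − ½)`) through the strip majorant (F2) and the monotonicity
of `‖γ̃‖` (F1), against the Laplace lower bound of the own window at abscissa `½ + a + h − O(1/ℓ)`:
margin `(ℓ_T/2)·a₀ − O(log ℓ_T)`, `ℓ_T ≍ ck/2`. -/
theorem stub_shellFar : ∀ c : ℝ, 7 ≤ c → c < 8 → ∃ k₂ : ℕ, ∀ k : ℕ, k₂ ≤ k → ∀ a T : ℝ,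
    2 / c - 1 / 4 < a → a ≤ 1 / 2 → 0 < T →
    Real.exp (c * ((k : ℝ) - 1)) / 4 ≤ ‖((a : ℂ) + (T : ℂ) * I) ^ 2‖ →
    ‖((a : ℂ) + (T : ℂ) * I) ^ 2‖ < Real.exp (c * (k : ℝ)) →
    ‖xiSqArcU k (bandRadius k T) (-(a : ℂ) + (T : ℂ) * I)‖ <
      ‖xiSqArcU k (bandRadius k T) ((a : ℂ) + (T : ℂ) * I)‖ := by
  intro c hc7 hc8
  -- constants of the rate: `a₀ = 2/c − 1/4`, `ψ₁ = a₀/160`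
  have hc0 : 0 < c := by linarith
  have ha₀ : 0 < 2 / c - 1 / 4 := by
    rw [sub_pos, lt_div_iff₀ hc0]; linarith
  have ha₀1 : 2 / c - 1 / 4 ≤ 1 / 28 := by
    rw [sub_le_iff_le_add, div_le_iff₀ hc0]; linarith
  have h4c : 4 / c = 1 / 2 + 2 * (2 / c - 1 / 4) := by ring
  have hψ₁ : 0 < (2 / c - 1 / 4) / 160 := by positivity
  -- thresholds
  obtain ⟨k₁, hk₁⟩ := shell_regime (max 100 (40 / (2 / c - 1 / 4))) hc7 hc8
  obtain ⟨kA, hkA⟩ := eventually_const_mul_sqrt_le (650 : ℝ)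
  obtain ⟨kB, hkB⟩ := eventually_sq_mul_exp_neg_le (A := 240 / (11 * ((2 / c - 1 / 4) / 160)))
    (b := 11 * ((2 / c - 1 / 4) / 160) ^ 2 / 40) (ε := 1) (by positivity) one_pos
  obtain ⟨kC, hkC⟩ := eventually_sq_mul_exp_neg_le
    (A := π * Real.exp 14 * (1 + 1 / (2 / c - 1 / 4))) (b := ((2 / c - 1 / 4) / 160) ^ 2 / 4)
    (ε := (2 / c - 1 / 4) / 4) (by positivity) (by positivity)
  obtain ⟨kD, hkD⟩ := eventually_sq_mul_exp_neg_le (A := 100800 * Real.exp 14)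
    (b := 7 * (2 / c - 1 / 4) / 4) (ε := (2 / c - 1 / 4) / 4) (by positivity) (by positivity)
  refine ⟨max (max k₁ 100) (max (max kA kB) (max kC kD)), ?_⟩
  intro k hk a T ha ha2 hT0 hlo hhi
  have hk₁' : k₁ ≤ k := le_trans (le_trans (le_max_left _ _) (le_max_left _ _)) hk
  have hk100 : 100 ≤ k := le_trans (le_trans (le_max_right _ _) (le_max_left _ _)) hk
  have hE1 : 650 * Real.sqrt k ≤ k :=
    hkA k (le_trans (le_trans (le_trans (le_max_left _ _) (le_max_left _ _)) (le_max_right _ _)) hk)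
  have hE2 := hkB k
    (le_trans (le_trans (le_trans (le_max_right _ _) (le_max_left _ _)) (le_max_right _ _)) hk)
  have hEC := hkC k
    (le_trans (le_trans (le_trans (le_max_left _ _) (le_max_right _ _)) (le_max_right _ _)) hk)
  have hED := hkD k
    (le_trans (le_trans (le_trans (le_max_right _ _) (le_max_right _ _)) (le_max_right _ _)) hk)
  have hkR : (100 : ℝ) ≤ k := by exact_mod_cast hk100
  have hk1 : (1 : ℝ) ≤ k := by linarith
  -- the regime
  have ha_pos : 0 < a := lt_trans ha₀ ha
  have hx : |a| ≤ 1 / 2 := abs_le.2 ⟨by linarith, ha2⟩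
  obtain ⟨hT100, -, hThi, hℓL, hℓlo, -, hh, hhc, hh35, hhT⟩ := hk₁ k hk₁' a T ha_pos ha2 hT0 hlo hhi
  clear hk₁ hkA hkB hkC hkD hlo hhi hk hk₁'
  have hℓ100 : 100 ≤ ell T := le_trans (le_max_left _ _) hℓL
  have hℓa : 40 / (2 / c - 1 / 4) ≤ ell T := le_trans (le_max_right _ _) hℓL
  clear hℓL
  have hℓ20 : 20 ≤ ell T := by linarith only [hℓ100]
  have hℓ0 : 0 < ell T := by linarith only [hℓ100]
  have hH : bandRadius k T ≤ 20 := by linarith only [hh35]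
  have hh0 : 0 < bandRadius k T := by linarith only [hh]
  have hhc' : 1 / 2 + 2 * (2 / c - 1 / 4) < bandRadius k T := by rw [← h4c]; exact hhc
  clear hhc
  -- the saddle of the own centre `a + iT`
  obtain ⟨u, hS, hu⟩ := exists_arcSaddleFn_eq_zero (n := k) hx hT100 hℓ20 hk100 hh hhT
  obtain ⟨hRe, -, hr_lo, hr_hi⟩ := arcSaddle_sharp_polar hx hT100 hℓ20 hk100 hh hhT hH hu hS
  obtain ⟨-, hεh, -, -, -⟩ := R2_bookkeeping (n := k) hT100 hℓ20 hh hH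
  -- `ε ≤ a₀/10`
  have hε_small : (2 + 16 / 5 * bandRadius k T) / ell T ≤ (2 / c - 1 / 4) / 10 := by
    have h1 : (2 + 16 / 5 * bandRadius k T) / ell T ≤ 3.92 / ell T :=
      div_le_div_of_nonneg_right (by linarith) hℓ0.le
    have h2 : 3.92 / ell T ≤ (2 / c - 1 / 4) / 10 := by
      rw [div_le_div_iff₀ hℓ0 (by norm_num)]
      have := (div_le_iff₀ ha₀).1 hℓa
      linarith only [this]
    linarith only [h1, h2]
  -- the window abscissa `σ* = ½ + a + Re(u − c)`
  have hσ_eq : (1 / 2 + u).re = 1 / 2 + a + (u - ((a : ℂ) + (T : ℂ) * I)).re := by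
    have e1 : (u - ((a : ℂ) + (T : ℂ) * I)).re = u.re - a := by simp
    have e2 : (1 / 2 + u).re = 1 / 2 + u.re := by simp
    rw [e1, e2]; ring
  -- `δc = max a₀ (h − ½ − a)`, kept opaque (no `max` in the context of `linarith`)
  obtain ⟨δc, hδc⟩ : ∃ δc : ℝ, δc = max (2 / c - 1 / 4) (bandRadius k T - 1 / 2 - a) := ⟨_, rfl⟩
  obtain ⟨hδc0, hδc1, hleft, hδcσ, hgain⟩ := far_deltas ha₀ ha₀1 ha hhc' hh35 hRe hε_small
  rw [← hδc] at hδc0 hδc1 hleft hδcσ hgain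
  clear hδc
  rw [← hσ_eq] at hδcσ hgain
  have hσa₀ : 1 + 2 * (2 / c - 1 / 4) ≤ (1 / 2 + u).re := by
    rw [hσ_eq]; linarith only [hRe, hhc', hε_small, ha, ha₀]
  have hσ1 : 1 < (1 / 2 + u).re := by linarith only [hσa₀, ha₀]
  have hgain₀ : 2 / c - 1 / 4 ≤ (1 / 2 + u).re - (1 + (2 / c - 1 / 4)) := by
    rw [hσ_eq]; linarith only [hRe, hhc', hε_small, ha, ha₀]
  -- window parameters
  have hψ₁s : (2 / c - 1 / 4) / 160 ≤ 11 / 320 := by linarith only [ha₀1]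
  have hr1 : ‖u - ((a : ℂ) + (T : ℂ) * I)‖ ≤ 1 := by linarith only [hr_hi, hh35, hε_small, ha₀1]
  have hr_pos : 0 < ‖u - ((a : ℂ) + (T : ℂ) * I)‖ := by linarith only [hr_lo, hh, hε_small, ha₀1]
  have hrinv : 1 / ‖u - ((a : ℂ) + (T : ℂ) * I)‖ ≤ 4 := by
    rw [div_le_iff₀ hr_pos]; linarith only [hr_lo, hh, hε_small, ha₀1]
  have hψ₁r : ‖u - ((a : ℂ) + (T : ℂ) * I)‖ * ((2 / c - 1 / 4) / 160) ≤ 1 / 20 * bandRadius k T := by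
    have h1 : ‖u - ((a : ℂ) + (T : ℂ) * I)‖ * ((2 / c - 1 / 4) / 160) ≤ 1 * (1 / 160) :=
      mul_le_mul hr1 (by linarith only [ha₀1]) (by positivity) (by norm_num)
    linarith only [h1, hh]
  have hwin : 1 + (2 / c - 1 / 4) + ‖u - ((a : ℂ) + (T : ℂ) * I)‖ * ((2 / c - 1 / 4) / 160) ≤
      (1 / 2 + u).re := by
    have h1 : ‖u - ((a : ℂ) + (T : ℂ) * I)‖ * ((2 / c - 1 / 4) / 160) ≤ 1 * ((2 / c - 1 / 4) / 160) :=
      mul_le_mul_of_nonneg_right hr1 (by positivity)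
    linarith only [h1, hσa₀, ha₀]
  have hδ1 : 2 / c - 1 / 4 ≤ 1 := by linarith only [ha₀1]
  have hbr : |bandRadius k T - ‖u - ((a : ℂ) + (T : ℂ) * I)‖| ≤ (2 + 16 / 5 * bandRadius k T) / ell T :=
    abs_le.2 ⟨by linarith only [hr_hi], by linarith only [hr_lo]⟩
  have hd1 : |bandRadius k T - ‖u - ((a : ℂ) + (T : ℂ) * I)‖| ≤ 1 := by
    linarith only [hbr, hε_small, ha₀1]
  have hρ : |bandRadius k T - ‖u - ((a : ℂ) + (T : ℂ) * I)‖| ≤ 5 / ell T := by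
    have h2 : (2 + 16 / 5 * bandRadius k T) / ell T ≤ 5 / ell T :=
      div_le_div_of_nonneg_right (by linarith only [hh35]) hℓ0.le
    exact hbr.trans h2
  -- (1) the competitor at `−a + iT`, with `δc = max a₀ (h − ½ − a)`
  have hx' : |(-a)| ≤ 1 / 2 := by rw [abs_neg]; exact hx
  have hcomp_pt : ∀ θ : ℝ, |θ| ≤ Real.pi / 2 →
      ‖arcIntegrandU k (bandRadius k T) (((-a : ℝ) : ℂ) + (T : ℂ) * I) θ‖ ≤
        672 * Real.log (T + bandRadius k T) * Real.exp (4 * bandRadius k T + 9) *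
          Real.exp (-(((1 / 2 + u).re - (1 + δc)) * (ell T / 2 - 1))) *
          ‖arcModelIntegrand k ‖u - ((a : ℂ) + (T : ℂ) * I)‖ ((a : ℂ) + (T : ℂ) * I)
            (Complex.arg (u - ((a : ℂ) + (T : ℂ) * I)))‖ :=
    fun θ hθ => norm_arcIntegrandU_competitor_le hx hT100 hℓ20 hk100 hh hhT hH hu hS hx' hδc0 hδc1
      hleft hδcσ hθ
  have hneg : (-(a : ℂ) + (T : ℂ) * I) = (((-a : ℝ) : ℂ) + (T : ℂ) * I) := by push_cast; ring
  have hUminus := norm_xiSqArcU_le_of_arc_bound k (bandRadius k T) (((-a : ℝ) : ℂ) + (T : ℂ) * I) hcomp_pt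
  rw [← hneg] at hUminus
  clear hcomp_pt
  -- (2) sizes at the own centre
  obtain ⟨-, hwre, hwnorm⟩ := descentDensity_saddle hx hT100 hℓ20 hk100 hh hhT hu hS
  have hZ := zeta_window_lower ha₀ ha₀1 hσa₀
  have hIpk_pos := arcModelIntegrand_saddle_norm_pos hx hT100 hh hhT hu
    (by linarith only [hRe, hh, hε_small, ha₀1]) hσ1
  have hMain := norm_arcMainTerm_eq_integrand k ((a : ℂ) + (T : ℂ) * I) u
  have hs := main_factor_ge hk1 hwre hwnorm
  -- (3) `W ≤ 1/√k`
  obtain ⟨hη0, hη_le⟩ := eta_small (a₀ := 2 / c - 1 / 4) (norm_nonneg (u - ((a : ℂ) + (T : ℂ) * I)))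
    hr1 ha₀
  have hRw : 11 * (k : ℝ) / 40 ≤ (deriv (arcSaddleFn k ((a : ℂ) + (T : ℂ) * I)) u *
      (u - ((a : ℂ) + (T : ℂ) * I)) ^ 2 / 2).re := by linarith only [hwre]
  have hW := window_bracket_le_inv_sqrt hk1 hRw hη0 hη_le hψ₁ hE1 hE2
  -- (4) the three exponentially small terms are `≤ a₀/(2√k)`
  have hlog_r := log_height_le (y := ‖u - ((a : ℂ) + (T : ℂ) * I)‖) hT100 hThi hc8 (norm_nonneg _)
    (by linarith only [hr1])
  have hlog_r1 := log_height_le (y := ‖u - ((a : ℂ) + (T : ℂ) * I)‖ + 1) hT100 hThi hc8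
    (by positivity) (by linarith only [hr1])
  have hlog_h := log_height_le (y := bandRadius k T) hT100 hThi hc8 hh0.le (by linarith only [hh35])
  have hlog_r10 : 0 ≤ Real.log (T + (‖u - ((a : ℂ) + (T : ℂ) * I)‖ + 1)) :=
    Real.log_nonneg (by linarith only [hT100, hr_pos])
  have hG₀ := gain_exp_le ha₀.le ha₀1 hc7 hk1 hℓlo (by linarith only [hℓ20]) hgain₀
  have hGc := gain_exp_le ha₀.le ha₀1 hc7 hk1 hℓlo (by linarith only [hℓ20]) hgain
  have hF := flank_bracket_le (k := k) ha₀ ha₀1 hh35 hlog_r hG₀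
  have hVB := bridge_bracket_le (k := k) hh35 hr_pos hrinv hd1 hlog_r10 hlog_r1 hG₀
  have hK := competitor_bracket_le (k := k) hh35 hlog_h hGc
  have hradd : T + (‖u - ((a : ℂ) + (T : ℂ) * I)‖ + 1) = T + ‖u - ((a : ℂ) + (T : ℂ) * I)‖ + 1 := by
    ring
  rw [hradd] at hVB
  have hJ := far_junk_le hk1 ha₀ hF hVB hK hEC hED
  -- (5) the window lemma at the own centre (radius `h`), and the abstract comparison
  have hN : 0 < (k.factorial : ℝ) / (2 * π) := by positivity
  have hsk : 0 < Real.sqrt k := Real.sqrt_pos.2 (by linarith only [hkR])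
  have hS5 := norm_xiSqArcU_sub_arcMainTerm_le' hx hT100 hℓ100 hk100 hh hhT hH hu hS hψ₁ hψ₁s hψ₁r ha₀
    hδ1 hwin hh0 hρ
  rw [norm_sub_rev] at hS5
  have hgap := (norm_sub_norm_le (arcMainTerm k ((a : ℂ) + (T : ℂ) * I) u)
    (xiSqArcU k (bandRadius k T) ((a : ℂ) + (T : ℂ) * I))).trans hS5
  exact far_dominance_core hN hIpk_pos hsk ha₀ hUminus hgap hMain hs hZ hW hJ

end Summit.RiemannHypothesis.RiemannHypothesis.Cruxes.XiDerivBandRealAllRates.UArc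

end
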